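import Summits.ResolutionOfSingularities.ResolutionOfSingularities.Theorems.NonRuledDivisors.Negative.OrbitGermEngineANotSurjective

/-!
# Crux `NonRuledDivisors` (stmt-ResolutionOfSingularities-18075), line `automorphism-orbit` —
# engine (A) on a NORMAL affine model needs a NON-FINITE (non-integral) contraction

Sequel to `Negative/OrbitGermEngineANotSurjective.lean` (engine (A) of `stub_orbitGerm`,
`P ≠ ⊥ ∧ τ P ⊆ P²`, is void when `τ` maps the affine model `R` onto itself).

Negative-side support (crux disprover, cycle 1), sorry-free, definition-free, resolution-free:

* `orbitGerm_surjOn_of_integral` — if a subring `S ⊆ K` is integrally closed in `K` and `τ S ⊆ S`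
  with `S` INTEGRAL over `τ S`, then `τ S = S`: for `r ∈ S` a monic relation over `τ S` pulls back
  along `τ⁻¹` to a monic relation for `τ⁻¹ r` over `S`, so `τ⁻¹ r ∈ S` by normality.
* `orbitGerm_engineA_false_of_normal_of_integral` — hence for a NORMAL affine model `R`
  (integrally closed in `K = Frac R`) and a contraction `τ` with `R` integral over `τ R` (i.e.
  `Spec τ|R` a FINITE birational endomorphism) the engine-(A) disjunct of `stub_orbitGerm` is
  impossible.

Moral for hunters: on a normal singular germ an engine-(A) map is a birational endomorphism that is
NOT finite — by Zariski's main theorem it contracts a positive-dimensional subvariety into the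
singular point (model case: the monomial map `(x, y) ↦ (xy, xy²)`, under which `k[x, y]` is not
integral over `k[xy, xy²]`); finite self-covers, Frobenius-like or Galois-like maps and automorphisms
are all excluded.  This file does NOT refute the crux or the stub (it removes a habitat).
-/

set_option linter.dupNamespace false

namespace Summit.ResolutionOfSingularities.ResolutionOfSingularities.Theorems

/-- **Normality forces a finite contraction to be onto.**  `S ⊆ K` integrally closed in `K`,
`τ` a ring automorphism of `K` with `τ S ⊆ S` and every element of `S` integral over the subring
`τ S`; then `τ` maps `S` onto `S`. [folklore] -/
theorem orbitGerm_surjOn_of_integral {K : Type*} [Field K] (S : Subring K) (τ : K ≃+* K)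
    (hnorm : ∀ x : K, IsIntegral S x → x ∈ S)
    (hint : ∀ r : K, r ∈ S → IsIntegral (S.map (τ : K →+* K)) r) :
    ∀ r : K, r ∈ S → ∃ r' : K, r' ∈ S ∧ τ r' = r := by
  intro r hr
  refine ⟨τ.symm r, ?_, τ.apply_symm_apply r⟩
  apply hnorm
  obtain ⟨f, hf, hfr⟩ := hint r hr
  -- `ψ : τ S → S`, `t ↦ τ⁻¹ t`
  have hψ : ∀ x ∈ S.map (τ : K →+* K), (τ.symm : K →+* K) x ∈ S := by
    intro x hx
    obtain ⟨s, hs, rfl⟩ := Subring.mem_map.mp hx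
    simpa using hs
  let ψ : S.map (τ : K →+* K) →+* S := (τ.symm : K →+* K).restrict _ S hψ
  refine ⟨f.map ψ, hf.map ψ, ?_⟩
  rw [Polynomial.eval₂_map]
  have hcomp : (algebraMap S K).comp ψ =
      (τ.symm : K →+* K).comp (algebraMap (S.map (τ : K →+* K)) K) :=
    RingHom.ext fun t => rfl
  have h := Polynomial.hom_eval₂ f (algebraMap (S.map (τ : K →+* K)) K) (τ.symm : K →+* K) r
  rw [hfr, map_zero] at h
  rw [hcomp]
  exact h.symm

/-- **Engine (A) of `stub_orbitGerm` is void for finite contractions of a normal model.**  For an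
affine model `R` (f.g. `k`-subalgebra of `K`) that is integrally closed in `K`, a prime `P` of `R`
and a ring automorphism `τ` of `K` with `τ R ⊆ R` and `R` integral over `τ R`, the certificate
`P ≠ ⊥ ∧ τ P ⊆ P²` (first disjunct of `stub_orbitGerm`, verbatim) fails. [folklore] -/
theorem orbitGerm_engineA_false_of_normal_of_integral {k K : Type} [Field k] [Field K]
    [Algebra k K] (R : Subalgebra k K) (hR : R.FG) (P : Ideal R.toSubring) [P.IsPrime]
    (τ : K ≃+* K) (hRτ : ∀ r : K, r ∈ R → τ r ∈ R)
    (hnorm : ∀ x : K, IsIntegral R.toSubring x → x ∈ R)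
    (hint : ∀ r : K, r ∈ R → IsIntegral (R.toSubring.map (τ : K →+* K)) r) :
    ¬ (P ≠ ⊥ ∧ ∀ r : R.toSubring, r ∈ P → ∃ r' : R.toSubring, r' ∈ P ^ 2 ∧ (r' : K) = τ (r : K)) :=
  orbitGerm_engineA_false_of_surjOn R hR P τ hRτ
    (orbitGerm_surjOn_of_integral R.toSubring τ hnorm hint)

end Summit.ResolutionOfSingularities.ResolutionOfSingularities.Theorems
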